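import Literature.Analysis.FluidPDE.CompressibleEulerImplosionSonicSeriesTM
import Literature.Analysis.FluidPDE.CompressibleEulerImplosionOriginSeriesTMCheck
import HarnessLib

/-!
# Buckmaster–Cao-Labora–Gómez-Serrano at `γ = 5/3`: checking literal Taylor models of the sonic series

Sequel of `CompressibleEulerImplosionSonicSeriesTM` (the Taylor-model mirrors `nextWTM` / `nextZTM` of the
coefficient recursions (2.9)–(2.10) of the analytic branch at `P_s`, with soundness `tmem_nextWTM`,
`tmem_nextZTM`). As for the centre series (`CompressibleEulerImplosionOriginSeriesTMCheck`), evaluating the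
generator in ONE kernel computation is too expensive, so the window files use a STEPWISE certificate: the models
`LW = [LW₀, …, LW_{N+1}]`, `LZ = [LZ₀, …, LZ_{N+1}]` are literal data, and the kernel checks `baseOK` (the data
models `W₀, Z₀, W₁, Z₁` built from the model `R ∋ r` and the verified square roots `qTM ∋ q(r)`, `pTM ∋ p(r)` are
contained in the first two entries, and the inverse of `D_{W,0}` validates) and, for each `n < N` separately,
`stepOK n` (the inverse of `slopeZ(n+2)` validates and the two forced models are contained in the entries `n + 2`).
Soundness `tmem_of_stepsOK`: then `LW_i ∋ (ρ ↦ wᵢ(r(ρ)))` and `LZ_i ∋ (ρ ↦ zᵢ(r(ρ)))` for all `i ≤ N + 1`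
(strong induction). Rational bounds of all coefficients are then read off with `OriginSeries.bndCheck`.
Problem-independent bookkeeping; no facts, no axioms.

[cite: BuckmasterCaolaboraGomezserrano2025, Prop. 2.2, eqs. (2.9)–(2.10), App. B]
-/

namespace Literature.Analysis.FluidPDE

namespace BuckmasterCaolaboraGomezserrano2025

namespace Monatomic

namespace SonicSeries

open Finset
open Literature.Analysis.ValidatedNumerics Literature.Analysis.ValidatedNumerics.PolyMP
open Literature.Analysis.ValidatedNumerics.NumericsMP
open OriginSeries (ent ipIncl tmem_of_ipIncl)

/-! ### The stepwise certificate -/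

/-- The data checks: the two verified square roots validate, the entries `0, 1` of the literal lists contain
the data models of `W₀, Z₀, W₁, Z₁`, and the inverse of `D_{W,0}` validates.
[cite: BuckmasterCaolaboraGomezserrano2025, §2.1, eqs. (2.2), (2.6)] -/
def baseOK (S : ℕ) (h : ℚ) (D : ℕ) (R : IPoly) (LW LZ : List IPoly) : Bool :=
  sqrtOK S h D (discTM S h D R) && sqrtOK S h D (ppTM S R) &&
  ipIncl (W0TM S R (qTM S h D R)) (ent S LW 0) && ipIncl (Z0TM S R (qTM S h D R)) (ent S LZ 0) &&
  ipIncl (W1TM (qTM S h D R)) (ent S LW 1) && ipIncl (Z1TM S R (qTM S h D R) (pTM S h D R)) (ent S LZ 1) &&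
  invOK S h D (dWc0TM S LW LZ)

/-- The step check at `n`: the model of `w_{n+2}` forced by the entries `≤ n + 1` is contained in `LW_{n+2}`,
the inverse of `slopeZ(n+2)` validates, and the model of `z_{n+2}` forced by the entries `≤ n + 2` of `LW`
and `≤ n + 1` of `LZ` is contained in `LZ_{n+2}`. [cite: BuckmasterCaolaboraGomezserrano2025, eqs. (2.9)–(2.10)] -/
def stepOK (S : ℕ) (h : ℚ) (D : ℕ) (R : IPoly) (LW LZ : List IPoly) (n : ℕ) : Bool :=
  ipIncl (nextWTM S h D R (tinvC S h D (dWc0TM S LW LZ)) LW LZ (n + 1)) (ent S LW (n + 2)) &&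
  invOK S h D (slopeZTM S R LW LZ (n + 2)) &&
  ipIncl (nextZTM S h D LW LZ n (tinvC S h D (slopeZTM S R LW LZ (n + 2)))) (ent S LZ (n + 2))

variable {S : ℕ} {h : ℚ} {D : ℕ} {R : IPoly} {rF : ℝ → ℝ}

/-- **Soundness of the stepwise certificate.** [cite: BuckmasterCaolaboraGomezserrano2025, Prop. 2.2, eqs. (2.9)–(2.10)] -/
theorem tmem_of_stepsOK (hS : 0 < S) (h0 : 0 ≤ h) (hR : TMem S h rF R)
    {LW LZ : List IPoly} {N : ℕ} (hbase : baseOK S h D R LW LZ = true)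
    (hsteps : ∀ n, n < N → stepOK S h D R LW LZ n = true) :
    ∀ i, i ≤ N + 1 → TMem S h (fun ρ => w (rF ρ) i) (ent S LW i) ∧ TMem S h (fun ρ => z (rF ρ) i) (ent S LZ i) := by
  simp only [baseOK, Bool.and_eq_true] at hbase
  obtain ⟨⟨⟨⟨⟨⟨hq, hp⟩, hW0⟩, hZ0⟩, hW1⟩, hZ1⟩, hIW⟩ := hbase
  obtain ⟨tW0, tZ0, tW1, tZ1⟩ := tmem_PsData (S := S) (h := h) hR (tmem_qTM hS h0 hR hq) (tmem_pTM hS h0 hR hp)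
  have e0 : TMem S h (fun ρ => w (rF ρ) 0) (ent S LW 0) ∧ TMem S h (fun ρ => z (rF ρ) 0) (ent S LZ 0) :=
    ⟨tmem_of_ipIncl hW0 tW0, tmem_of_ipIncl hZ0 tZ0⟩
  have e1 : TMem S h (fun ρ => w (rF ρ) 1) (ent S LW 1) ∧ TMem S h (fun ρ => z (rF ρ) 1) (ent S LZ 1) :=
    ⟨tmem_of_ipIncl hW1 tW1, tmem_of_ipIncl hZ1 tZ1⟩
  have tIW : TMem S h (fun ρ => (dWc (w (rF ρ)) (z (rF ρ)) 0)⁻¹) (tinvC S h D (dWc0TM S LW LZ)) :=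
    tmem_tinvC hS h0 (tmem_dWc0TM (F := fun ρ i => w (rF ρ) i) (G := fun ρ i => z (rF ρ) i) e0.1 e0.2) hIW
  intro i
  induction i using Nat.strong_induction_on with
  | _ i ih =>
    intro hi
    match i, ih, hi with
    | 0, _, _ => exact e0
    | 1, _, _ => exact e1
    | n + 2, ih, hi =>
      have hn : n < N := by omega
      have hst := hsteps n hn
      simp only [stepOK, Bool.and_eq_true] at hst
      obtain ⟨⟨hw, hinv⟩, hz⟩ := hst
      have hL : ∀ j, j ≤ n + 1 → TMem S h (fun ρ => w (rF ρ) j) (ent S LW j) :=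
        fun j hj => (ih j (by omega) (by omega)).1
      have hM : ∀ j, j ≤ n + 1 → TMem S h (fun ρ => z (rF ρ) j) (ent S LZ j) :=
        fun j hj => (ih j (by omega) (by omega)).2
      have tw : TMem S h (fun ρ => w (rF ρ) (n + 2)) (ent S LW (n + 2)) :=
        tmem_of_ipIncl hw (tmem_nextWTM hS h0 hR tIW hL hM)
      have hL' : ∀ j, j ≤ n + 2 → TMem S h (fun ρ => w (rF ρ) j) (ent S LW j) := by
        intro j hj
        rcases Nat.lt_or_ge j (n + 2) with hlt | hge
        · exact hL j (by omega)
        · have : j = n + 2 := by omega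
          subst this; exact tw
      have tIZ : TMem S h (fun ρ => (slopeZ (rF ρ) (w (rF ρ)) (z (rF ρ)) (n + 2))⁻¹)
          (tinvC S h D (slopeZTM S R LW LZ (n + 2))) :=
        tmem_tinvC hS h0 (tmem_slopeZTM (F := fun ρ i => w (rF ρ) i) (G := fun ρ i => z (rF ρ) i) hR
          e0.1 e0.2 e1.1 e1.2 (n + 2)) hinv
      exact ⟨tw, tmem_of_ipIncl hz (tmem_nextZTM hS h0 hL' hM tIZ)⟩

/-- The standard window set-up: `r(ρ) = r_m + ρ` with the model `rTM`. [folklore] -/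
theorem tmem_of_stepsOK_window (hS : 0 < S) (h0 : 0 ≤ h) (rm : ℚ)
    {LW LZ : List IPoly} {N : ℕ} (hbase : baseOK S h D (rTM S rm) LW LZ = true)
    (hsteps : ∀ n, n < N → stepOK S h D (rTM S rm) LW LZ n = true) {i : ℕ} (hi : i ≤ N + 1) :
    TMem S h (fun ρ => w ((rm : ℝ) + ρ) i) (ent S LW i) ∧ TMem S h (fun ρ => z ((rm : ℝ) + ρ) i) (ent S LZ i) :=
  tmem_of_stepsOK (rF := fun ρ => (rm : ℝ) + ρ) hS h0 (tmem_rTM S h rm) hbase hsteps i hi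

/-! ### Reading absolute bounds of all coefficients at once -/

/-- Check `tabsI Lᵢ ≤ Bᵢ · S` for the listed bounds. [folklore] -/
def absCheck (S : ℕ) (h : ℚ) : List IPoly → List ℚ → Bool
  | _, [] => true
  | [], _ :: _ => false
  | P :: L, b :: bs => decide (tabsI S h P ≤ b * S) && absCheck S h L bs

/-- **Soundness of `absCheck`**: `|fᵢ(ρ)| ≤ Bᵢ` on `|ρ| ≤ h`. [folklore] -/
theorem abs_of_absCheck (hS : 0 < S) (h0 : 0 ≤ h) :
    ∀ (L : List IPoly) (bs : List ℚ) (f : ℕ → ℝ → ℝ), absCheck S h L bs = true →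
      (∀ i, i < bs.length → TMem S h (f i) (ent S L i)) →
      ∀ i, i < bs.length → ∀ {ρ : ℝ}, |ρ| ≤ h → |f i ρ| ≤ ((bs.getD i 0 : ℚ) : ℝ)
  | _, [], _, _, _, i, hi, _, _ => by simp at hi
  | [], _ :: _, _, hc, _, _, _, _, _ => by simp [absCheck] at hc
  | P :: L, b :: bs, f, hc, hL, i, hi, ρ, hρ => by
      simp only [absCheck, Bool.and_eq_true, decide_eq_true_eq] at hc
      obtain ⟨h1, hrest⟩ := hc
      cases i with
      | zero =>
        have hP : TMem S h (f 0) P := by simpa [ent] using hL 0 (by simp)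
        have hb := abs_le_tabsI h0 hP hρ
        have h1' : ((tabsI S h P : ℤ) : ℝ) ≤ ((b : ℚ) : ℝ) * S := by exact_mod_cast h1
        have hS' : (0 : ℝ) < S := by exact_mod_cast hS
        have : |f 0 ρ| ≤ ((b : ℚ) : ℝ) := le_of_mul_le_mul_right (hb.trans h1') hS'
        simpa using this
      | succ j =>
        have hj : j < bs.length := by simpa using hi
        have hL' : ∀ i, i < bs.length → TMem S h (f (i + 1)) (ent S L i) := fun i hi' => by
          have := hL (i + 1) (by simpa using hi')
          simpa [ent] using this
        have := abs_of_absCheck hS h0 L bs (fun i => f (i + 1)) hrest hL' j hj hρ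
        simpa using this

end SonicSeries

end Monatomic

end BuckmasterCaolaboraGomezserrano2025

end Literature.Analysis.FluidPDE
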